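import Summits.RiemannHypothesis.RiemannHypothesis.Theorems.PfPersistenceF5WithinRangeRigidity
import Summits.RiemannHypothesis.RiemannHypothesis.Theorems.PfPersistenceF6SpectralShift

/-!
# F5-INJ for `ζ`'s table: no within-range fake at a window with `⌊e^{2a}⌋ ≤ N + 1` (fake seat 5, gen 4)

Mechanism / rigidity campaign `pub-rhpf` (FAKE SEAT 5); **no RH claims** — RH-free, weight-free statements about
the even-block map `w ↦ evenBlock w win` of `PfPersistenceAdmissibleClass.lean`.

`PfPersistenceF5WithinRangeRigidity.lean` proves THEOREM F5-INJ relative to a chosen support `S` (`#S ≤ N`) on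
which two tables may differ.  Here the support is ALL reached non-degenerate integer positions
`reachedPositions win = {q ≤ e^{2a} | 2 ≤ q ∧ log q < 2a}` (at most `⌊e^{2a}⌋ − 1` of them), which gives the
hypothesis-light form used in `HOME/FAKES.md §5.1`:

* `weights_eq_of_evenBlock_eq_of_floor_le`: if `⌊e^{2a}⌋ ≤ N + 1`, two tables that agree at the two junk positions
  `0, 1` (both sit at `y = 0`) and have the same even block at `(a, N)` agree at EVERY `2 ≤ q` with `log q < 2a`
  (the endpoint `log q = 2a` is invisible, `evenBlock_congr_off_endpoint`, and is exactly what is excluded).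
* `eq_zetaWeights_of_evenBlock_eq`: a table vanishing at `0, 1` whose `(a, N)` block IS `ζ`'s block
  (`⌊e^{2a}⌋ ≤ N + 1`, e.g. every served `a ≤ 1.96` with `N ≥ 100`, where `e^{2a} ≤ 50.4`) coincides with
  `Λ(q) q^{-1/2}` at every position `2 ≤ q < e^{2a}` — prime power or not (`zetaWeights 1 = 0` is reused from
  `PfPersistenceF6SpectralShift.lean`, `F6Shift.zetaWeights_one`).

Labels: every `theorem` is PROVED here; nothing is DATA.
-/

set_option linter.dupNamespace false

noncomputable section

open Real Finset

namespace Summit.RiemannHypothesis.RiemannHypothesis.Theorems.PfPersistence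

/-- The reached, non-degenerate integer positions of a window: `2 ≤ q`, `log q < 2a` (inside `primeRange (2a)`).
[folklore] -/
def reachedPositions (win : Window) : Finset ℕ :=
  (primeRange (2 * win.a)).filter (fun q => 2 ≤ q ∧ Real.log q < 2 * win.a)

/-- PROVED: membership in `reachedPositions`. [folklore] -/
theorem mem_reachedPositions {win : Window} {q : ℕ} :
    q ∈ reachedPositions win ↔ 2 ≤ q ∧ Real.log q < 2 * win.a := by
  rw [reachedPositions, Finset.mem_filter]
  exact ⟨fun h => h.2, fun h => ⟨mem_primeRange_of_log_lt h.2, h⟩⟩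

/-- PROVED: there are at most `⌊e^{2a}⌋ − 1` reached non-degenerate positions. [folklore] -/
theorem card_reachedPositions_le (win : Window) :
    (reachedPositions win).card ≤ ⌊Real.exp (2 * win.a)⌋₊ - 1 := by
  have hsub : reachedPositions win ⊆ Finset.Icc 2 ⌊Real.exp (2 * win.a)⌋₊ := by
    intro q hq
    rw [reachedPositions, Finset.mem_filter, primeRange, Finset.mem_range] at hq
    rw [Finset.mem_Icc]
    exact ⟨hq.2.1, by omega⟩
  have h := Finset.card_le_card hsub
  rw [Nat.card_Icc] at h
  omega

/-- PROVED: a position in `primeRange (2a)` that is not reached-non-degenerate is a junk position `0, 1` or the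
endpoint `log q = 2a`. [folklore] -/
theorem eq_endpoint_of_mem_primeRange_of_not_mem {win : Window} {q : ℕ} (hq : q ∈ primeRange (2 * win.a))
    (hqS : q ∉ reachedPositions win) (h2 : 2 ≤ q) : Real.log q = 2 * win.a := by
  rw [mem_reachedPositions] at hqS
  have hge : 2 * win.a ≤ Real.log q := by
    by_contra hlt; push Not at hlt; exact hqS ⟨h2, hlt⟩
  have hle : Real.log q ≤ 2 * win.a := by
    rw [primeRange, Finset.mem_range, Nat.lt_succ_iff] at hq
    have hqpos : (0 : ℝ) < q := by exact_mod_cast (show 0 < q by omega)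
    rw [Real.log_le_iff_le_exp hqpos]
    exact (Nat.cast_le.2 hq).trans (Nat.floor_le (Real.exp_pos _).le)
  exact le_antisymm hle hge

/-- **PROVED (F5-INJ, hypothesis-light form).** At a window with `⌊e^{2a}⌋ ≤ N + 1`, two weight tables that agree
at the junk positions `0, 1` and have the same even block agree at every reached non-degenerate position
`2 ≤ q`, `log q < 2a`.  Nothing is assumed at the (invisible) endpoint `log q = 2a`. [folklore] -/
theorem weights_eq_of_evenBlock_eq_of_floor_le (win : Window) (hN : ⌊Real.exp (2 * win.a)⌋₊ ≤ win.N + 1)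
    {w w' : Weights} (h0 : w 0 = w' 0) (h1 : w 1 = w' 1) (heq : evenBlock w win = evenBlock w' win) :
    ∀ q : ℕ, 2 ≤ q → Real.log q < 2 * win.a → w q = w' q := by
  classical
  have ha := win.ha
  -- move `w'` to `w` AT the endpoint (invisible), so that the two tables agree off `reachedPositions`
  set w'' : Weights := fun q => if Real.log q = 2 * win.a then w q else w' q with hw''
  have heq' : evenBlock w win = evenBlock w'' win := by
    rw [heq]
    exact evenBlock_congr_off_endpoint win fun q _ hq => by simp [hw'', hq]
  have hcard : (reachedPositions win).card ≤ win.N := (card_reachedPositions_le win).trans (by omega)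
  have hoff : ∀ q ∈ primeRange (2 * win.a), q ∉ reachedPositions win → w q = w'' q := by
    intro q hq hqS
    by_cases h2 : 2 ≤ q
    · have hend := eq_endpoint_of_mem_primeRange_of_not_mem hq hqS h2
      simp [hw'', hend]
    · interval_cases q
      · have : Real.log ((0 : ℕ) : ℝ) ≠ 2 * win.a := by simp; linarith
        simp only [hw'', this, if_false]; exact h0
      · have : Real.log ((1 : ℕ) : ℝ) ≠ 2 * win.a := by simp; linarith
        simp only [hw'', this, if_false]; exact h1
  intro q h2 hlt
  have hmem : q ∈ reachedPositions win := mem_reachedPositions.2 ⟨h2, hlt⟩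
  have h := weights_eq_of_evenBlock_eq win (S := reachedPositions win) (fun q hq => mem_reachedPositions.1 hq)
    hcard hoff heq' q hmem
  simpa [hw'', hlt.ne] using h

/-- PROVED: `ζ`'s table vanishes at the junk position `0`. [folklore] -/
theorem zetaWeights_zero : zetaWeights 0 = 0 := by simp [zetaWeights]

/-- **PROVED (no within-range fake of `ζ`).** A weight table vanishing at the junk positions `0, 1` whose even
block at ONE window `(a, N)` with `⌊e^{2a}⌋ ≤ N + 1` equals `ζ`'s block there coincides with `Λ(q) q^{-1/2}` at
every position `2 ≤ q < e^{2a}` (prime power or not).  RH-free. [folklore] -/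
theorem eq_zetaWeights_of_evenBlock_eq (win : Window) (hN : ⌊Real.exp (2 * win.a)⌋₊ ≤ win.N + 1)
    {w : Weights} (h0 : w 0 = 0) (h1 : w 1 = 0) (heq : evenBlock w win = evenBlock zetaWeights win) :
    ∀ q : ℕ, 2 ≤ q → Real.log q < 2 * win.a → w q = zetaWeights q :=
  weights_eq_of_evenBlock_eq_of_floor_le win hN (h0.trans zetaWeights_zero.symm) (h1.trans F6Shift.zetaWeights_one.symm)
    heq

/-- PROVED (contrapositive, the F5 reading): a table vanishing at `0, 1` that differs from `ζ`'s at some position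
`2 ≤ q < e^{2a}` is SEEN by the window `(a, N)` (`⌊e^{2a}⌋ ≤ N + 1`): the blocks differ. [folklore] -/
theorem evenBlock_ne_of_ne_zetaWeights (win : Window) (hN : ⌊Real.exp (2 * win.a)⌋₊ ≤ win.N + 1)
    {w : Weights} (h0 : w 0 = 0) (h1 : w 1 = 0) {q : ℕ} (h2 : 2 ≤ q) (hlt : Real.log q < 2 * win.a)
    (hne : w q ≠ zetaWeights q) : evenBlock w win ≠ evenBlock zetaWeights win :=
  fun heq => hne (eq_zetaWeights_of_evenBlock_eq win hN h0 h1 heq q h2 hlt)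

end Summit.RiemannHypothesis.RiemannHypothesis.Theorems.PfPersistence
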